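import Literature.MathematicalPhysics.QuantumFieldTheory.Balaban1983to89.B9Thm32SiteXBoundsY

/-!
# `Balaban1983to89.B9Thm32SiteCVariationalY` — T. Bałaban, *Propagators for lattice gauge theories in a background field*, Commun. Math. Phys. **99** (1985)
# 389–434 [Balaban1985BackgroundPropagators] (3.21)–(3.25) pp. 394–395 ∕ Thm 3.2 (3.48) p. 398, with [4] = [Balaban1984PropagatorsII] (2.15)–(2.17) p. 225:
# ★ **THE VARIATIONAL PRINCIPLE FOR `C(U) = (Q′G′²Q′\*)⁻¹(U)` AT def-Y's LETTERS** — for EVERY unitary-valued background and every test field `φ` with `Q′(U)φ = f`: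
# `⟨f, C(U)f⟩_W ≤ ‖Δ′_a(U)φ‖²₁` (equality at the minimiser `φ = G′²Q′\*Cf` of (3.22)'s Lagrange problem), and the working form
# `⟨Q′(U)φ, g⟩²_W ≤ ‖Δ′_a(U)φ‖²₁·⟨g, (Q′G′²Q′\*)(U)g⟩_W` — the algebraic socket (V1) of dag-n06-j's road map to the certificate binder `h348` (rows 15–16)
# (file 18 of the site-coercivity set of width seat `pub-ymgap-dag-n06-w1`)

statement-level skeleton of published theorems with citation tags; proofs where landed; nothing here is a claim about the Yang–Mills mass gap

THE PRINT.  (3.21)–(3.22) p. 394: *«R = R(U) is an orthogonal projection … onto the subspace ℛ = Δ^η_U N(Q′) … Rf = Δ^η_Uλ₀ where λ₀ is a minimum of the function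
λ ∈ N(Q′), λ ↦ ‖f − Δ^η_Uλ‖²»*; (3.25): *«Using the Lagrange multipliers method the minimum of (3.22) can be found by the same calculations as in [4], (2.15)–(2.17),
and we obtain the formula Rf = (I − G′Q′\*(Q′G′²Q′\*)⁻¹Q′G′)f»*; Thm 3.2 p. 398 bounds the kernel of `(Q′G′²Q′\*)⁻¹` by `B₀(Lʲη)⁻²(Lʲ′η)^{−d}e^{−δ₀d(y,y′)}`.  The same
Lagrange structure gives the variational reading of `C = (Q′G′²Q′\*)⁻¹`: `⟨f, Cf⟩ = min{‖Δ′_aφ‖² : Q′φ = f}`, minimiser `φ = G′²Q′\*Cf`.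

WHY THIS FILE (cell context).  File 12 (`B9Thm32SiteXBoundsY`) bounds `C(U)` UNIFORMLY (`O(1)`); print's (3.48) is SMALLER by the scale factor `(Lʲη)⁻²·(…)` and
decays.  dag-n06-j's located road map for the certificate binder `h348` (bus l.27332, «VARIATIONAL COERCIVITY + COMBES–THOMAS», (V1)–(V4)) starts from the
variational principle: the scale factor needs ONE good test field `φ` per block function `f` (a rotated flat interpolant, (V2)), not a lower bound on `G′`.  THIS
FILE proves (V1) at def-Y's letters, for every `G`-valued `U` with no smallness: the upper bound `⟨f, C(U)f⟩_W ≤ ‖Δ′_a(U)φ‖²₁` whenever `Q′(U)φ = f`, and the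
Cauchy–Schwarz working form for `X = Q′G′²Q′\*`.  (V2)–(V4) (the test fields, the decay, the scale transfer) are NOT here.

THE ARGUMENT.  `⟨f, Cf⟩_W = ⟨Q′φ, Cf⟩_W = ⟨φ, Q′\*Cf⟩₁ = ⟨φ, Δ′_a(G′Q′\*Cf)⟩₁ = ⟨Δ′_aφ, G′Q′\*Cf⟩₁ ≤ ‖Δ′_aφ‖₁·‖G′Q′\*Cf‖₁` and `‖G′Q′\*Cf‖²₁ = ⟨Cf, XCf⟩_W = ⟨Cf, f⟩_W =
⟨f, Cf⟩_W` (file 12's `trIP_wB_XY_eq`, `XC = I`, symmetry of `C`); hence `⟨f,Cf⟩ ≤ ‖Δ′_aφ‖·⟨f,Cf⟩^{1∕2}`.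

WHAT IS PROVED (sorry-free; 0 `def`; nothing of [B9] asserted beyond what is proved).
* `isSymmTr_XinvY_parSymY` (`C(U)` is `W`-symmetric), `trIP_XinvY_self_eq_GpQps` (`⟨f, C f⟩_W = ‖G′Q′\*Cf‖²₁`), ★★ `trIP_QpY_sq_le` (the working form:
  `⟨Q′(U)φ, g⟩²_W ≤ ‖Δ′_a(U)φ‖²₁·⟨g, (Q′G′²Q′\*)(U)g⟩_W`, every `G`-valued `U`), ★★★ **`trIP_XinvY_le_of_QpY_eq`** (THE VARIATIONAL UPPER BOUND: `Q′(U)φ = f ⇒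
  ⟨f, C(U)f⟩_W ≤ ‖Δ′_a(U)φ‖²₁`), ★ `trIP_XinvY_eq_at_minimiser` (equality at `φ = G′(U)²Q′\*(U)C(U)f`, which satisfies the constraint).
MODEL ∕ DECLARED READINGS.  def-Y's letters `QpY ∕ QpsY ∕ GpY ∕ deltaPrimeAY ∕ XY ∕ XinvY` at `parSymY`, the block-volume pairing `trIP (wB i)`; `G ≤ U(N)`, `U` `G`-valued,
no smallness.  NON-VACUITY: `Q′(U)` is onto (def-Y `QY_surjective`-type facts; here the constraint is a hypothesis and the minimiser exhibits a solution).  NOT HERE: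
(V2)–(V4) of the road map, Thm 3.2's scale factor and decay, `h348`.  HONEST SCOPE.  Finite-dimensional algebra; NOT a node discharge, NOT summit progress;
count-neutral; nothing continuum ∕ OS ∕ mass gap ∕ Clay.  NEW file importing file 12 only.
-/

noncomputable section

namespace Literature.MathematicalPhysics.QuantumFieldTheory.Balaban1983to89.B9Thm32SiteCVariationalY

open Literature.MathematicalPhysics.QuantumFieldTheory.Balaban1983to89
open Node00 B6KLevelCensusIndexV1 B6Geom246MultiLevelBox B6MultiLevelBoxOperator B6MultiLevelTorusOperator B6GlobalChartV1 B9BackgroundsKLevelV1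
  B9Eq39Adjoint B9Thm311ReadingCoords B9Thm311DeltaPrimePos B9Ineq369CurvatureSmallAtLettersY B9Thm31SiteCoerciveGaugeBlockY
  B9Thm31SiteCoerciveReg335Y B9Thm31SiteGpBoundsReg335Y B9Thm32SiteXBoundsY
open Literature.MathematicalPhysics.QuantumFieldTheory.Balaban1983to89.B9Ineq349SiteAdjoint (trIP_comm isSymmTr_GpY_parSymY isSymmTr_ringInverse)
open Literature.MathematicalPhysics.QuantumFieldTheory.Balaban1983to89.B9Thm311SymmAtRecordV4 (adj_parSymY symm0_parSymY)
open Literature.MathematicalPhysics.QuantumFieldTheory.Balaban1983to89.B9Thm311ReadingAtLetters (wB wB_pos)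
open Literature.MathematicalPhysics.QuantumFieldTheory.Balaban1983to89.B9Thm311PosAtRecordV4 (isUnit_XY_parSymY)
open scoped Matrix Matrix.Norms.L2Operator

variable {d ℓ : ℕ} {hd : 1 ≤ d + 1} {hL : Odd (ℓ + 1) ∧ 1 < ℓ + 1} {b₀ b₁ : ℝ}
variable (i : KIdx d ℓ hd hL b₀ b₁) {N : ℕ} {G : Subgroup (Matrix (Fin N) (Fin N) ℂ)ˣ}

/-- `C(U) = (Q′G′²Q′\*)⁻¹(U)` is symmetric for the block-volume pairing at every `G`-valued `U`, `G ≤ U(N)`. [cite: Balaban1985BackgroundPropagators, Thm 3.11 p.416 («symmetric»)] -/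
theorem isSymmTr_XinvY_parSymY (hG : G ≤ B7Prop2Explicit.unitaryUnits (Matrix (Fin N) (Fin N) ℂ)) {U : CfgY (Matrix (Fin N) (Fin N) ℂ) i}
    (hU : ∀ μ x, U μ x ∈ G) : IsSymmTr (wB i) (XinvY i (parSymY i) (GpY i (parSymY i)) U) :=
  isSymmTr_ringInverse _ (isSymmTr_XY_parSymY i hG hU)

/-- `⟨f, C(U)f⟩_W = ‖G′(U)Q′\*(U)C(U)f‖²₁` (`XC = I` and the form of `X`). [cite: Balaban1985BackgroundPropagators, (3.25) pp.394–395, bookkeeping] -/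
theorem trIP_XinvY_self_eq_GpQps (hG : G ≤ B7Prop2Explicit.unitaryUnits (Matrix (Fin N) (Fin N) ℂ)) {U : CfgY (Matrix (Fin N) (Fin N) ℂ) i}
    (hU : ∀ μ x, U μ x ∈ G) (f : BlkY i → Matrix (Fin N) (Fin N) ℂ) :
    trIP (wB i) f (XinvY i (parSymY i) (GpY i (parSymY i)) U f)
      = trIP (fun _ => (1 : ℝ)) (GpY i (parSymY i) U (QpsY i (parSymY i) U (XinvY i (parSymY i) (GpY i (parSymY i)) U f)))
          (GpY i (parSymY i) U (QpsY i (parSymY i) U (XinvY i (parSymY i) (GpY i (parSymY i)) U f))) := by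
  have hX : XinvY i (parSymY i) (GpY i (parSymY i)) U = Ring.inverse (XY i (parSymY i) (GpY i (parSymY i)) U) := rfl
  have hXC : XY i (parSymY i) (GpY i (parSymY i)) U (XinvY i (parSymY i) (GpY i (parSymY i)) U f) = f := by
    rw [hX]; exact apply_inverse_of_isUnit (isUnit_XY_parSymY i hG hU) f
  rw [← trIP_wB_XY_eq i hG hU, hXC, trIP_comm]

/-- ★★ **THE WORKING FORM**: for every site field `φ` and block function `g`, `⟨Q′(U)φ, g⟩²_W ≤ ‖Δ′_a(U)φ‖²₁·⟨g, (Q′G′²Q′\*)(U)g⟩_W` at every `G`-valued `U`, `G ≤ U(N)`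
(`⟨Q′φ, g⟩_W = ⟨φ, Q′\*g⟩₁ = ⟨Δ′_aφ, G′Q′\*g⟩₁`, Cauchy–Schwarz, `‖G′Q′\*g‖² = ⟨g, Xg⟩_W`) — so a lower bound on `X` along `g` needs ONE test field, not a bound on `G′`.
[cite: Balaban1985BackgroundPropagators, (3.22)–(3.25) pp.394–395; Balaban1984PropagatorsII, (2.15)–(2.17) p.225] -/
theorem trIP_QpY_sq_le (hG : G ≤ B7Prop2Explicit.unitaryUnits (Matrix (Fin N) (Fin N) ℂ)) {U : CfgY (Matrix (Fin N) (Fin N) ℂ) i}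
    (hU : ∀ μ x, U μ x ∈ G) (φ : SiteY i → Matrix (Fin N) (Fin N) ℂ) (g : BlkY i → Matrix (Fin N) (Fin N) ℂ) :
    trIP (wB i) (QpY i (parSymY i) U φ) g ^ 2
      ≤ trIP (fun _ => (1 : ℝ)) (deltaPrimeAY i (parSymY i) U φ) (deltaPrimeAY i (parSymY i) U φ) * trIP (wB i) g (XY i (parSymY i) (GpY i (parSymY i)) U g) := by
  have hunit : IsUnit (deltaPrimeAY i (parSymY i) U) := isUnit_deltaPrimeAY_parSymY i hG hU
  -- `⟨Q′φ, g⟩_W = ⟨φ, Q′*g⟩₁ = ⟨φ, Δ′(G′Q′*g)⟩₁ = ⟨Δ′φ, G′Q′*g⟩₁`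
  have h1 : trIP (wB i) (QpY i (parSymY i) U φ) g
      = trIP (fun _ => (1 : ℝ)) (deltaPrimeAY i (parSymY i) U φ) (GpY i (parSymY i) U (QpsY i (parSymY i) U g)) := by
    have hΔG : deltaPrimeAY i (parSymY i) U (GpY i (parSymY i) U (QpsY i (parSymY i) U g)) = QpsY i (parSymY i) U g := apply_inverse_of_isUnit hunit _
    rw [adj_parSymY i hG hU, ← hΔG, ← symm0_parSymY i hG hU]
    rw [hΔG]
  rw [h1, trIP_wB_XY_eq i hG hU]
  exact trIP_sq_le _ (fun _ => one_pos) _ _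

/-- ★★★ **THE VARIATIONAL UPPER BOUND FOR `C(U) = (Q′G′²Q′\*)⁻¹(U)`**: at every `G`-valued background, `G ≤ U(N)` (no smallness), for every block function `f` and every
site field `φ` with `Q′(U)φ = f`: `⟨f, C(U)f⟩_W ≤ ‖Δ′_a(U)φ‖²₁`. [cite: Balaban1985BackgroundPropagators, (3.22)–(3.25) pp.394–395, Thm 3.2 p.398; Balaban1984PropagatorsII, (2.15)–(2.17) p.225] -/
theorem trIP_XinvY_le_of_QpY_eq (hG : G ≤ B7Prop2Explicit.unitaryUnits (Matrix (Fin N) (Fin N) ℂ)) {U : CfgY (Matrix (Fin N) (Fin N) ℂ) i}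
    (hU : ∀ μ x, U μ x ∈ G) {φ : SiteY i → Matrix (Fin N) (Fin N) ℂ} {f : BlkY i → Matrix (Fin N) (Fin N) ℂ} (hφ : QpY i (parSymY i) U φ = f) :
    trIP (wB i) f (XinvY i (parSymY i) (GpY i (parSymY i)) U f) ≤ trIP (fun _ => (1 : ℝ)) (deltaPrimeAY i (parSymY i) U φ) (deltaPrimeAY i (parSymY i) U φ) := by
  set Cf := XinvY i (parSymY i) (GpY i (parSymY i)) U f with hCf
  have hX : XinvY i (parSymY i) (GpY i (parSymY i)) U = Ring.inverse (XY i (parSymY i) (GpY i (parSymY i)) U) := rfl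
  have hXC : XY i (parSymY i) (GpY i (parSymY i)) U Cf = f := by rw [hCf, hX]; exact apply_inverse_of_isUnit (isUnit_XY_parSymY i hG hU) f
  -- `a := ⟨f, Cf⟩_W`; the working form at `g = Cf`: `a² ≤ ‖Δ′φ‖²·⟨Cf, XCf⟩ = ‖Δ′φ‖²·a`
  have hw := trIP_QpY_sq_le i hG hU φ Cf
  rw [hφ, hXC, trIP_comm (wB i) Cf f] at hw
  have ha0 : 0 ≤ trIP (wB i) f Cf := by
    rw [hCf, trIP_XinvY_self_eq_GpQps i hG hU f]; exact trIP_self_nonneg _ (fun _ => one_pos) _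
  have hb0 : 0 ≤ trIP (fun _ => (1 : ℝ)) (deltaPrimeAY i (parSymY i) U φ) (deltaPrimeAY i (parSymY i) U φ) := trIP_self_nonneg _ (fun _ => one_pos) _
  rcases ha0.eq_or_lt with h0 | hpos
  · rw [← h0]; exact hb0
  · have h2 : trIP (wB i) f Cf * trIP (wB i) f Cf ≤ trIP (fun _ => (1 : ℝ)) (deltaPrimeAY i (parSymY i) U φ) (deltaPrimeAY i (parSymY i) U φ) * trIP (wB i) f Cf := by
      nlinarith
    exact le_of_mul_le_mul_right h2 hpos

/-- ★ **EQUALITY AT THE MINIMISER** `φ⋆ = G′(U)²Q′\*(U)C(U)f` (which satisfies the constraint `Q′(U)φ⋆ = f`): `‖Δ′_a(U)φ⋆‖²₁ = ⟨f, C(U)f⟩_W` — so the variational bound is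
sharp: `⟨f, C(U)f⟩_W = min{‖Δ′_a(U)φ‖²₁ : Q′(U)φ = f}`. [cite: Balaban1985BackgroundPropagators, (3.22)–(3.25) pp.394–395; Balaban1984PropagatorsII, (2.15)–(2.17) p.225] -/
theorem trIP_XinvY_eq_at_minimiser (hG : G ≤ B7Prop2Explicit.unitaryUnits (Matrix (Fin N) (Fin N) ℂ)) {U : CfgY (Matrix (Fin N) (Fin N) ℂ) i}
    (hU : ∀ μ x, U μ x ∈ G) (f : BlkY i → Matrix (Fin N) (Fin N) ℂ) :
    QpY i (parSymY i) U (GpY i (parSymY i) U (GpY i (parSymY i) U (QpsY i (parSymY i) U (XinvY i (parSymY i) (GpY i (parSymY i)) U f)))) = f ∧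
      trIP (fun _ => (1 : ℝ)) (deltaPrimeAY i (parSymY i) U (GpY i (parSymY i) U (GpY i (parSymY i) U (QpsY i (parSymY i) U (XinvY i (parSymY i) (GpY i (parSymY i)) U f)))))
          (deltaPrimeAY i (parSymY i) U (GpY i (parSymY i) U (GpY i (parSymY i) U (QpsY i (parSymY i) U (XinvY i (parSymY i) (GpY i (parSymY i)) U f)))))
        = trIP (wB i) f (XinvY i (parSymY i) (GpY i (parSymY i)) U f) := by
  have hunit : IsUnit (deltaPrimeAY i (parSymY i) U) := isUnit_deltaPrimeAY_parSymY i hG hU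
  have hX : XinvY i (parSymY i) (GpY i (parSymY i)) U = Ring.inverse (XY i (parSymY i) (GpY i (parSymY i)) U) := rfl
  have hXC : XY i (parSymY i) (GpY i (parSymY i)) U (XinvY i (parSymY i) (GpY i (parSymY i)) U f) = f := by
    rw [hX]; exact apply_inverse_of_isUnit (isUnit_XY_parSymY i hG hU) f
  constructor
  · -- `Q′G′G′Q′*Cf = X(Cf) = f`
    exact hXC
  · have hΔ : deltaPrimeAY i (parSymY i) U (GpY i (parSymY i) U (GpY i (parSymY i) U (QpsY i (parSymY i) U (XinvY i (parSymY i) (GpY i (parSymY i)) U f))))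
        = GpY i (parSymY i) U (QpsY i (parSymY i) U (XinvY i (parSymY i) (GpY i (parSymY i)) U f)) := apply_inverse_of_isUnit hunit _
    rw [hΔ, ← trIP_XinvY_self_eq_GpQps i hG hU f]

end Literature.MathematicalPhysics.QuantumFieldTheory.Balaban1983to89.B9Thm32SiteCVariationalY
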